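import Summits.QuantumFields.YangMills.Theorems.UnitScaleTiltProp7PTermLocalGaugeKnit
import Summits.QuantumFields.YangMills.Theorems.UnitScaleTiltProp7LocalHessianComparison
import Summits.QuantumFields.YangMills.Theorems.UnitScaleTiltProp7LocalComparisonArithmetic
import Summits.QuantumFields.YangMills.Theorems.UnitScaleTiltProp7SectET3CurvedPropagatorsT3
import Summits.QuantumFields.YangMills.Theorems.UnitScaleTiltProp7LaplaceAFlatLetters
import HarnessLib

/-!
# Route `UnitScaleTilt`, crux K1 «MinimiserStabilityRegPr» (stmt-QuantumFields-19200), EX row `hGF[Lift]` (curved member) — **LOD LINE, (L6) `hcmp`-KNIT FILE B (MEMBER):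
# THE PER-CUBE COMPARISON `(1 − θ′)·q_1((Ad_σX)~) − e·‖X̃‖² ≤ q_{U₀}(X̃)`** — w5 g13's binder `hcmp` of ✓∕⧗`Prop7LODAssembly.curvedTarget_of_LOD_topMean` at one cube piece `X`
# (`supp X` in the cube, `U₀^σ` δ-close to `1` there), assembled from (L5a) ✓`Prop7LocalHessianComparison` (w7), (L5b) ✓`Prop7LocalDivergenceComparison` (px12),
# (L5″) ✓`Prop7PTermLocalGaugeKnit` (this seat) and the displayed (L5c) row (routeR-w4 `…QkLocalGaugeComparison.normSq_Qk_one_conj_le`) + the flat H¹ absorption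
# (★p1 ✓`Prop7RTermFloor.normSq_adjoint_le_normSq_projR_add`), through the arithmetic of ✓`Prop7LocalComparisonArithmetic`.

Cell `ym3-torus` (HUMAN RULING D-0037, YM ladder rung R3 — NOT d = 4, NOT infinite volume, NOT a mass gap, NOT Clay).  Width seat `ym-routeR-w3` gen 12 («MINE hcmp-knit»
2026-08-30 00:44:48Z; ★p1 g24 BOOKED 00:45:36Z).  THEOREMS ONLY (0 `def`, 0 `sorry`); `--supports stmt-QuantumFields-19200 --as helper`, count-neutral.  HONEST LABEL (★★OWNER
RULING №33 (6)): curved γ-row supplier line (LOD localisation), (L6) per-cube comparison; a KNIT — the analytic content sits in the cited rows and in the three DISPLAYED hypotheses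
`hloc` (the (L5″) local projector row, suppliers px5∕routeR-w2 via ✓`Prop7ProjectorPerturbationGram`∕✓`Prop7ColumnPairingRows`), `hKrow` (the (L5c) one-sided `Q_k` row, routeR-w4 g26's
`normSq_Qk_one_conj_le` VERBATIM), `hP1abs` (flat H¹ absorption, ★p1's ✓p750717 at `U = 1` with the flat massive data); nothing of (3.49), Thm 3.1∕3.3∕3.11, `h349`, `hGF`, `hT`,
EX ∕ 19200 is proved here.

THE FUNCTIONALS (w5's letters): `q_U(A) = re⟪A, Δ^η_U A⟫ + ‖R_U(D*_U A)‖² + a·‖Q_k(U)A‖²`, `R_U = projR (covLapSite U) Q″_U`, `a = a₀(c₀∕cB)(L^{K−n})³`; by Org-I line 1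
(✓`normSq_sub_projR_eq`) `‖R_U(D*A)‖² = ‖D*A‖² − ‖D*A − R_U(D*A)‖² = D − P`.

WHAT IS PROVED (ns `Summit.QuantumFields.YangMills.Theorems.Prop7LocalComparisonKnit`).
* `re_inner_DeltaEta_one_nonneg` (the flat Hessian is a sum of squares, ✓`re_inner_DeltaEta_one`).
* ★★★ `localComparison_of_cube` — THE `hcmp` ROW at one piece: for `θ ∈ (0,1]`, `δP ≥ 0` with `3θ + δP ≤ 1`,
  `(1 − (3θ + δP))·q_1((Ad_σX)~) − e·‖X̃‖² ≤ q_{U₀}(X̃)`, `e = (1+θ⁻¹)·40·η⁻²δ² + (1+θ)·1029ε₀ + a·(1+θ⁻¹)·c_K + (2θ + δP)·c₆` (all from the rows' constants; `η⁻²δ² = 4R″²ε₀²` at the member).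

References: T. Bałaban, CMP **99** (1985) 389–434 [Balaban1985BackgroundPropagators] ((3.4)–(3.12) pp.391–392, (3.20)–(3.27) pp.394–395, Thm 3.11 p.416); CMP **99** (1985) 75–102
[Balaban1985RegularSpaces] (Lemma 1 (1.25) p.79); CMP **98** (1985) 17–51 [Balaban1985Averaging] (Prop. 3 (124)–(126) p.36).
-/

set_option autoImplicit false

noncomputable section

open scoped BigOperators Matrix.Norms.L2Operator InnerProductSpace ComplexConjugate

namespace Summit.QuantumFields.YangMills.Theorems.Prop7LocalComparisonKnit

open Literature.MathematicalPhysics.QuantumFieldTheory.Balaban1983to89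
open Literature.MathematicalPhysics.QuantumFieldTheory.Balaban1983to89.T3ContinuumYM3Torus
open Literature.MathematicalPhysics.QuantumFieldTheory.Balaban1983to89.T3PrintedRegularMinimiser (RegPr)
open T4Continuum BlockAveraging
open BlockAveraging (Idx)
open B7Prop1Explicit (disp)
open B10Eq27TorusAxialLog (holT transl)
open B7TransferAnalyticMean (meanCLM)
open B15DeterminingSets (embIter)
open B11Eq103H1Complex (SiteL2K BondL2K projR)
open Summit.QuantumFields.YangMills.Theorems.Prop8Chart (emlIterU)
open T3SectALandauChart (eta eta_pos bgUnits)
open B9Eq39Adjoint (curl)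
open Summit.QuantumFields.YangMills.Theorems.Prop7SectET3Transport (periodsT3)
open Summit.QuantumFields.YangMills.Theorems.Prop7SectET3HilbertLetters (W₂ toL2 toL2S DstarL2 covLapSite)
open Summit.QuantumFields.YangMills.Theorems.Prop7SectET3WilsonHessian (DeltaEta)
open Summit.QuantumFields.YangMills.Theorems.Prop7SectET3CurvedPropagators (Qk)
open Summit.QuantumFields.YangMills.Theorems.Prop7LocalDivergenceComparison (abs_normSq_DstarL2_sub_normSq_DstarL2_one_conj_le norm_toL2_conj_eq)
open Summit.QuantumFields.YangMills.Theorems.Prop7LocalHessianComparison (abs_re_inner_DeltaEta_sub_flat_conj_le')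
open Summit.QuantumFields.YangMills.Theorems.Prop7PTermLocalGaugeKnit (abs_normSq_Pterm_sub_flat_le normSq_sub_projR_eq norm_sub_projR_le)
open Summit.QuantumFields.YangMills.Theorems.Prop7LocalComparisonArithmetic (localComparison_of_four_rows)
open Summit.QuantumFields.YangMills.Theorems.Prop7LaplaceAFlatLetters (re_inner_DeltaEta_one)

variable (F : T3Family) {n K : ℕ} (h : n ≤ K) (c₀ cB : ℝ) [Fact (0 < c₀)] [Fact (0 < cB)]

/-- The flat Hessian form is non-negative: `0 ≤ re⟪Ỹ, Δ^η(1)Ỹ⟫` (`= c₀η⁻²·Σ‖curl‖²`, ✓`re_inner_DeltaEta_one`). [cite: Balaban1985BackgroundPropagators, (3.4) p.391, (3.10) p.392] -/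
theorem re_inner_DeltaEta_one_nonneg (Y : PBond (F.P K) 0 → Matrix (Fin 2) (Fin 2) ℂ) :
    0 ≤ RCLike.re ⟪toL2 F K c₀ Y, DeltaEta F n K c₀ 1 (toL2 F K c₀ Y)⟫_ℂ := by
  rw [re_inner_DeltaEta_one]
  have hc₀ : 0 < c₀ := Fact.out
  exact mul_nonneg (by positivity) (Finset.sum_nonneg fun _ _ => Finset.sum_nonneg fun _ _ => Finset.sum_nonneg fun _ _ => sq_nonneg _)

-- decl-local heartbeat insurance (elaborates at the default 200000 in ≈ 25 s on the farm; the `set` abstractions over the member letters cost ≈ 150k): cell rule «decl-local ≤ 400000, never file-global».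
set_option maxHeartbeats 400000 in
/-- ★★★ **THE `hcmp` ROW AT ONE CUBE PIECE** (w5 g13's binder of `curvedTarget_of_LOD_topMean`, member letters).  DATA: `U₀ ∈ 𝔘_k(ε₀)`; an `SU(2)` gauge transformation `σ`
(member: a global extension of the axial gauge of the concentric cube) with `W := U₀^σ` δ-close to `1` near `supp X` in the three shapes the rows take (`hVplaq`: plaquette-adjacent
bonds, (L5a); `hVbond`: the support itself, (L5b)(L5″); `hKrow` carries its own comb∕run hypothesis, (L5c)); averaging-of-record maps `Q₀` at `U₀`, `Q₁` at `W`, `Qf` at `1`;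
DISPLAYED ROWS: `hloc` (the (L5″) local projector row at `(W, 1)`), `hKrow` (the (L5c) one-sided `Q_k` row with constant `cK`), `hP1abs` (flat H¹ absorption with constant `c₆`);
parameters `0 < θ`, `0 ≤ δP`, `3θ + δP ≤ 1`, `0 ≤ a`, `0 ≤ cK`.  CONCLUSION, with `Ỹ := (Ad_σX)~ = toL2 (b ↦ σ(b₋)X(b)σ(b₋)*)`:
**`(1 − (3θ + δP))·(re⟪Ỹ, Δ^η_1Ỹ⟫ + ‖R_1(∂*Ỹ)‖² + a‖Q_k(1)Ỹ‖²) − e·‖X̃‖² ≤ re⟪X̃, Δ^η_{U₀}X̃⟫ + ‖R_{U₀}(D*_{U₀}X̃)‖² + a‖Q_k(U₀)X̃‖²`**,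
`e = ((1+θ⁻¹)(16η⁻²δ²) + (1+θ)(1029ε₀)) + (1+θ⁻¹)(12η⁻²δ²) + (1+θ⁻¹)(12η⁻²δ²) + a·cK + (2θ + δP)·c₆`.
[cite: Balaban1985BackgroundPropagators, (3.4)–(3.12) pp.391–392, (3.20)–(3.27) pp.394–395, Thm 3.11 p.416; Balaban1985RegularSpaces, Lemma 1 (1.25) p.79] -/
theorem localComparison_of_cube {ε₀ : ℝ} (hε₀ : 0 ≤ ε₀) (σ : GaugeTransf (F.P K) 0 (Matrix.specialUnitaryGroup (Fin 2) ℂ))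
    (U₀ : GaugeField (F.P K) 0 (Matrix.specialUnitaryGroup (Fin 2) ℂ)) (hreg : RegPr F n K ε₀ U₀)
    (Q₀ : SiteL2K ℂ 3 (periodsT3 F K) c₀ W₂ →ₗ[ℂ] (Site (F.P K) (K - n) → Matrix (Fin 2) (Fin 2) ℂ))
    (hseq₀ : (∀ lam : Site (F.P K) 0 → Matrix (Fin 2) (Fin 2) ℂ, ∃ ns : (j : ℕ) → Site (F.P K) j → Matrix (Fin 2) (Fin 2) ℂ, ns 0 = lam ∧
      (∀ (j : ℕ) (y : Site (F.P K) (j + 1)), ns (j + 1) y = ns j (emb y) - meanCLM (Idx (F.P K)) (Matrix (Fin 2) (Fin 2) ℂ) fun i : Idx (F.P K) =>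
        ns j (emb y) - ((holT (emlIterU j (bgUnits F K U₀)) (emb y) (stairWord i.2.1 (off i.1)) : (Matrix (Fin 2) (Fin 2) ℂ)ˣ) : Matrix (Fin 2) (Fin 2) ℂ) *
          ns j (transl (emb y) (disp (stairWord i.2.1 (off i.1)))) * (((holT (emlIterU j (bgUnits F K U₀)) (emb y) (stairWord i.2.1 (off i.1)))⁻¹ : (Matrix (Fin 2) (Fin 2) ℂ)ˣ) : Matrix (Fin 2) (Fin 2) ℂ)) ∧
      ns (K - n) = Q₀ (toL2S F K c₀ lam)))
    (Q₁ : SiteL2K ℂ 3 (periodsT3 F K) c₀ W₂ →ₗ[ℂ] (Site (F.P K) (K - n) → Matrix (Fin 2) (Fin 2) ℂ))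
    (hseq₁ : (∀ lam : Site (F.P K) 0 → Matrix (Fin 2) (Fin 2) ℂ, ∃ ns : (j : ℕ) → Site (F.P K) j → Matrix (Fin 2) (Fin 2) ℂ, ns 0 = lam ∧
      (∀ (j : ℕ) (y : Site (F.P K) (j + 1)), ns (j + 1) y = ns j (emb y) - meanCLM (Idx (F.P K)) (Matrix (Fin 2) (Fin 2) ℂ) fun i : Idx (F.P K) =>
        ns j (emb y) - ((holT (emlIterU j (bgUnits F K (GaugeField.gaugeAct σ U₀))) (emb y) (stairWord i.2.1 (off i.1)) : (Matrix (Fin 2) (Fin 2) ℂ)ˣ) : Matrix (Fin 2) (Fin 2) ℂ) *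
          ns j (transl (emb y) (disp (stairWord i.2.1 (off i.1)))) * (((holT (emlIterU j (bgUnits F K (GaugeField.gaugeAct σ U₀))) (emb y) (stairWord i.2.1 (off i.1)))⁻¹ : (Matrix (Fin 2) (Fin 2) ℂ)ˣ) : Matrix (Fin 2) (Fin 2) ℂ)) ∧
      ns (K - n) = Q₁ (toL2S F K c₀ lam)))
    (Qf : SiteL2K ℂ 3 (periodsT3 F K) c₀ W₂ →ₗ[ℂ] (Site (F.P K) (K - n) → Matrix (Fin 2) (Fin 2) ℂ))
    (X : PBond (F.P K) 0 → Matrix (Fin 2) (Fin 2) ℂ) {δ δP θ a cK c₆ : ℝ} (hδ : 0 ≤ δ) (hδP : 0 ≤ δP) (hθ : 0 < θ) (hsmall : 3 * θ + δP ≤ 1) (ha : 0 ≤ a) (hcK : 0 ≤ cK)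
    (hVplaq : ∀ (x : Site (F.P K) 0) (μ ν : Fin (F.P K).d), μ ≠ ν → X ⟨x.shift μ, ν⟩ ≠ 0 →
      ‖((GaugeField.gaugeAct σ U₀ ⟨x, μ⟩ : Matrix.specialUnitaryGroup (Fin 2) ℂ) : Matrix (Fin 2) (Fin 2) ℂ) - 1‖ ≤ δ)
    (hVbond : ∀ b : PBond (F.P K) 0, X b ≠ 0 → ‖((GaugeField.gaugeAct σ U₀ b : Matrix.specialUnitaryGroup (Fin 2) ℂ) : Matrix (Fin 2) (Fin 2) ℂ) - 1‖ ≤ δ)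
    (hloc : ‖⟪DstarL2 F n K c₀ (GaugeField.gaugeAct σ U₀) (toL2 F K c₀ (fun b => ((σ b.src : Matrix.specialUnitaryGroup (Fin 2) ℂ) : Matrix (Fin 2) (Fin 2) ℂ) * X b * star ((σ b.src : Matrix.specialUnitaryGroup (Fin 2) ℂ) : Matrix (Fin 2) (Fin 2) ℂ))),
        (DstarL2 F n K c₀ (GaugeField.gaugeAct σ U₀) (toL2 F K c₀ (fun b => ((σ b.src : Matrix.specialUnitaryGroup (Fin 2) ℂ) : Matrix (Fin 2) (Fin 2) ℂ) * X b * star ((σ b.src : Matrix.specialUnitaryGroup (Fin 2) ℂ) : Matrix (Fin 2) (Fin 2) ℂ)))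
          - projR (covLapSite F n K c₀ (GaugeField.gaugeAct σ U₀)) Q₁ (DstarL2 F n K c₀ (GaugeField.gaugeAct σ U₀) (toL2 F K c₀ (fun b => ((σ b.src : Matrix.specialUnitaryGroup (Fin 2) ℂ) : Matrix (Fin 2) (Fin 2) ℂ) * X b * star ((σ b.src : Matrix.specialUnitaryGroup (Fin 2) ℂ) : Matrix (Fin 2) (Fin 2) ℂ)))))
        - (DstarL2 F n K c₀ (GaugeField.gaugeAct σ U₀) (toL2 F K c₀ (fun b => ((σ b.src : Matrix.specialUnitaryGroup (Fin 2) ℂ) : Matrix (Fin 2) (Fin 2) ℂ) * X b * star ((σ b.src : Matrix.specialUnitaryGroup (Fin 2) ℂ) : Matrix (Fin 2) (Fin 2) ℂ)))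
          - projR (covLapSite F n K c₀ 1) Qf (DstarL2 F n K c₀ (GaugeField.gaugeAct σ U₀) (toL2 F K c₀ (fun b => ((σ b.src : Matrix.specialUnitaryGroup (Fin 2) ℂ) : Matrix (Fin 2) (Fin 2) ℂ) * X b * star ((σ b.src : Matrix.specialUnitaryGroup (Fin 2) ℂ) : Matrix (Fin 2) (Fin 2) ℂ)))))⟫_ℂ‖
      ≤ δP * ‖DstarL2 F n K c₀ (GaugeField.gaugeAct σ U₀) (toL2 F K c₀ (fun b => ((σ b.src : Matrix.specialUnitaryGroup (Fin 2) ℂ) : Matrix (Fin 2) (Fin 2) ℂ) * X b * star ((σ b.src : Matrix.specialUnitaryGroup (Fin 2) ℂ) : Matrix (Fin 2) (Fin 2) ℂ)))‖ ^ 2)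
    (hKrow : ‖Qk F n K h c₀ cB (1 : GaugeField (F.P K) 0 (Matrix.specialUnitaryGroup (Fin 2) ℂ)) (toL2 F K c₀ (fun b => ((σ b.src : Matrix.specialUnitaryGroup (Fin 2) ℂ) : Matrix (Fin 2) (Fin 2) ℂ) * X b * star ((σ b.src : Matrix.specialUnitaryGroup (Fin 2) ℂ) : Matrix (Fin 2) (Fin 2) ℂ)))‖ ^ 2
      ≤ (1 + θ) * ‖Qk F n K h c₀ cB U₀ (toL2 F K c₀ X)‖ ^ 2 + cK * ‖toL2 F K c₀ X‖ ^ 2)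
    (hP1abs : ‖DstarL2 F n K c₀ 1 (toL2 F K c₀ (fun b => ((σ b.src : Matrix.specialUnitaryGroup (Fin 2) ℂ) : Matrix (Fin 2) (Fin 2) ℂ) * X b * star ((σ b.src : Matrix.specialUnitaryGroup (Fin 2) ℂ) : Matrix (Fin 2) (Fin 2) ℂ)))‖ ^ 2
      ≤ ‖projR (covLapSite F n K c₀ 1) Qf (DstarL2 F n K c₀ 1 (toL2 F K c₀ (fun b => ((σ b.src : Matrix.specialUnitaryGroup (Fin 2) ℂ) : Matrix (Fin 2) (Fin 2) ℂ) * X b * star ((σ b.src : Matrix.specialUnitaryGroup (Fin 2) ℂ) : Matrix (Fin 2) (Fin 2) ℂ))))‖ ^ 2 + c₆ * ‖toL2 F K c₀ (fun b => ((σ b.src : Matrix.specialUnitaryGroup (Fin 2) ℂ) : Matrix (Fin 2) (Fin 2) ℂ) * X b * star ((σ b.src : Matrix.specialUnitaryGroup (Fin 2) ℂ) : Matrix (Fin 2) (Fin 2) ℂ))‖ ^ 2) :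
    (1 - (3 * θ + δP)) * (RCLike.re ⟪toL2 F K c₀ (fun b => ((σ b.src : Matrix.specialUnitaryGroup (Fin 2) ℂ) : Matrix (Fin 2) (Fin 2) ℂ) * X b * star ((σ b.src : Matrix.specialUnitaryGroup (Fin 2) ℂ) : Matrix (Fin 2) (Fin 2) ℂ)), DeltaEta F n K c₀ 1 (toL2 F K c₀ (fun b => ((σ b.src : Matrix.specialUnitaryGroup (Fin 2) ℂ) : Matrix (Fin 2) (Fin 2) ℂ) * X b * star ((σ b.src : Matrix.specialUnitaryGroup (Fin 2) ℂ) : Matrix (Fin 2) (Fin 2) ℂ)))⟫_ℂ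
          + ‖projR (covLapSite F n K c₀ 1) Qf (DstarL2 F n K c₀ 1 (toL2 F K c₀ (fun b => ((σ b.src : Matrix.specialUnitaryGroup (Fin 2) ℂ) : Matrix (Fin 2) (Fin 2) ℂ) * X b * star ((σ b.src : Matrix.specialUnitaryGroup (Fin 2) ℂ) : Matrix (Fin 2) (Fin 2) ℂ))))‖ ^ 2
          + a * ‖Qk F n K h c₀ cB (1 : GaugeField (F.P K) 0 (Matrix.specialUnitaryGroup (Fin 2) ℂ)) (toL2 F K c₀ (fun b => ((σ b.src : Matrix.specialUnitaryGroup (Fin 2) ℂ) : Matrix (Fin 2) (Fin 2) ℂ) * X b * star ((σ b.src : Matrix.specialUnitaryGroup (Fin 2) ℂ) : Matrix (Fin 2) (Fin 2) ℂ)))‖ ^ 2)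
        - (((1 + θ⁻¹) * (16 * ((eta F n K)⁻¹) ^ 2 * δ ^ 2) + (1 + θ) * (1029 * ε₀)) + (1 + θ⁻¹) * (12 * ((eta F n K)⁻¹) ^ 2 * δ ^ 2)
            + (1 + θ⁻¹) * (12 * ((eta F n K)⁻¹) ^ 2 * δ ^ 2) + a * cK + (2 * θ + δP) * c₆) * ‖toL2 F K c₀ X‖ ^ 2
      ≤ RCLike.re ⟪toL2 F K c₀ X, DeltaEta F n K c₀ U₀ (toL2 F K c₀ X)⟫_ℂ
          + ‖projR (covLapSite F n K c₀ U₀) Q₀ (DstarL2 F n K c₀ U₀ (toL2 F K c₀ X))‖ ^ 2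
          + a * ‖Qk F n K h c₀ cB U₀ (toL2 F K c₀ X)‖ ^ 2 := by
  -- the four rows, BEFORE abbreviating (so that `set` rewrites them too)
  have ha_row := abs_re_inner_DeltaEta_sub_flat_conj_le' F n K c₀ hε₀ σ U₀ hreg X hθ hVplaq
  have hb_row := abs_normSq_DstarL2_sub_normSq_DstarL2_one_conj_le F n K c₀ σ U₀ X hθ hVbond
  have hp_row := abs_normSq_Pterm_sub_flat_le F c₀ σ U₀ Q₀ hseq₀ Q₁ hseq₁ Qf X hδ hθ hVbond hloc
  have hnXσ' := norm_toL2_conj_eq F K c₀ σ X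
  have hRU' := normSq_sub_projR_eq (covLapSite F n K c₀ U₀) Q₀ (DstarL2 F n K c₀ U₀ (toL2 F K c₀ X))
  have hR1' := normSq_sub_projR_eq (covLapSite F n K c₀ 1) Qf
    (DstarL2 F n K c₀ 1 (toL2 F K c₀ (fun b => ((σ b.src : Matrix.specialUnitaryGroup (Fin 2) ℂ) : Matrix (Fin 2) (Fin 2) ℂ) * X b * star ((σ b.src : Matrix.specialUnitaryGroup (Fin 2) ℂ) : Matrix (Fin 2) (Fin 2) ℂ))))
  have hP1D1' := norm_sub_projR_le (covLapSite F n K c₀ 1) Qf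
    (DstarL2 F n K c₀ 1 (toL2 F K c₀ (fun b => ((σ b.src : Matrix.specialUnitaryGroup (Fin 2) ℂ) : Matrix (Fin 2) (Fin 2) ℂ) * X b * star ((σ b.src : Matrix.specialUnitaryGroup (Fin 2) ℂ) : Matrix (Fin 2) (Fin 2) ℂ))))
  have hH1nn := re_inner_DeltaEta_one_nonneg F c₀ (n := n) (fun b => ((σ b.src : Matrix.specialUnitaryGroup (Fin 2) ℂ) : Matrix (Fin 2) (Fin 2) ℂ) * X b * star ((σ b.src : Matrix.specialUnitaryGroup (Fin 2) ℂ) : Matrix (Fin 2) (Fin 2) ℂ))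
  have hη2n : (0 : ℝ) ≤ ((eta F n K)⁻¹) ^ 2 := by positivity
  have hnX0 : (0 : ℝ) ≤ ‖toL2 F K c₀ X‖ := norm_nonneg _
  have hP10 := norm_nonneg (DstarL2 F n K c₀ 1 (toL2 F K c₀ (fun b => ((σ b.src : Matrix.specialUnitaryGroup (Fin 2) ℂ) : Matrix (Fin 2) (Fin 2) ℂ) * X b * star ((σ b.src : Matrix.specialUnitaryGroup (Fin 2) ℂ) : Matrix (Fin 2) (Fin 2) ℂ)))
    - projR (covLapSite F n K c₀ 1) Qf (DstarL2 F n K c₀ 1 (toL2 F K c₀ (fun b => ((σ b.src : Matrix.specialUnitaryGroup (Fin 2) ℂ) : Matrix (Fin 2) (Fin 2) ℂ) * X b * star ((σ b.src : Matrix.specialUnitaryGroup (Fin 2) ℂ) : Matrix (Fin 2) (Fin 2) ℂ)))))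
  clear hloc hVplaq hVbond hseq₀ hseq₁
  -- letters
  set HU : ℝ := RCLike.re ⟪toL2 F K c₀ X, DeltaEta F n K c₀ U₀ (toL2 F K c₀ X)⟫_ℂ with hHU
  set H1 : ℝ := RCLike.re ⟪toL2 F K c₀ (fun b => ((σ b.src : Matrix.specialUnitaryGroup (Fin 2) ℂ) : Matrix (Fin 2) (Fin 2) ℂ) * X b * star ((σ b.src : Matrix.specialUnitaryGroup (Fin 2) ℂ) : Matrix (Fin 2) (Fin 2) ℂ)),
    DeltaEta F n K c₀ 1 (toL2 F K c₀ (fun b => ((σ b.src : Matrix.specialUnitaryGroup (Fin 2) ℂ) : Matrix (Fin 2) (Fin 2) ℂ) * X b * star ((σ b.src : Matrix.specialUnitaryGroup (Fin 2) ℂ) : Matrix (Fin 2) (Fin 2) ℂ)))⟫_ℂ with hH1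
  set DU : ℝ := ‖DstarL2 F n K c₀ U₀ (toL2 F K c₀ X)‖ with hDU
  set D1 : ℝ := ‖DstarL2 F n K c₀ 1 (toL2 F K c₀ (fun b => ((σ b.src : Matrix.specialUnitaryGroup (Fin 2) ℂ) : Matrix (Fin 2) (Fin 2) ℂ) * X b * star ((σ b.src : Matrix.specialUnitaryGroup (Fin 2) ℂ) : Matrix (Fin 2) (Fin 2) ℂ)))‖ with hD1
  set PU : ℝ := ‖DstarL2 F n K c₀ U₀ (toL2 F K c₀ X) - projR (covLapSite F n K c₀ U₀) Q₀ (DstarL2 F n K c₀ U₀ (toL2 F K c₀ X))‖ with hPU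
  set P1 : ℝ := ‖DstarL2 F n K c₀ 1 (toL2 F K c₀ (fun b => ((σ b.src : Matrix.specialUnitaryGroup (Fin 2) ℂ) : Matrix (Fin 2) (Fin 2) ℂ) * X b * star ((σ b.src : Matrix.specialUnitaryGroup (Fin 2) ℂ) : Matrix (Fin 2) (Fin 2) ℂ)))
    - projR (covLapSite F n K c₀ 1) Qf (DstarL2 F n K c₀ 1 (toL2 F K c₀ (fun b => ((σ b.src : Matrix.specialUnitaryGroup (Fin 2) ℂ) : Matrix (Fin 2) (Fin 2) ℂ) * X b * star ((σ b.src : Matrix.specialUnitaryGroup (Fin 2) ℂ) : Matrix (Fin 2) (Fin 2) ℂ))))‖ with hP1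
  set RU : ℝ := ‖projR (covLapSite F n K c₀ U₀) Q₀ (DstarL2 F n K c₀ U₀ (toL2 F K c₀ X))‖ with hRU
  set R1 : ℝ := ‖projR (covLapSite F n K c₀ 1) Qf (DstarL2 F n K c₀ 1 (toL2 F K c₀ (fun b => ((σ b.src : Matrix.specialUnitaryGroup (Fin 2) ℂ) : Matrix (Fin 2) (Fin 2) ℂ) * X b * star ((σ b.src : Matrix.specialUnitaryGroup (Fin 2) ℂ) : Matrix (Fin 2) (Fin 2) ℂ))))‖ with hR1
  set KU : ℝ := ‖Qk F n K h c₀ cB U₀ (toL2 F K c₀ X)‖ with hKU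
  set K1 : ℝ := ‖Qk F n K h c₀ cB (1 : GaugeField (F.P K) 0 (Matrix.specialUnitaryGroup (Fin 2) ℂ)) (toL2 F K c₀ (fun b => ((σ b.src : Matrix.specialUnitaryGroup (Fin 2) ℂ) : Matrix (Fin 2) (Fin 2) ℂ) * X b * star ((σ b.src : Matrix.specialUnitaryGroup (Fin 2) ℂ) : Matrix (Fin 2) (Fin 2) ℂ)))‖ with hK1
  set nX : ℝ := ‖toL2 F K c₀ X‖ with hnX
  set nY : ℝ := ‖toL2 F K c₀ (fun b => ((σ b.src : Matrix.specialUnitaryGroup (Fin 2) ℂ) : Matrix (Fin 2) (Fin 2) ℂ) * X b * star ((σ b.src : Matrix.specialUnitaryGroup (Fin 2) ℂ) : Matrix (Fin 2) (Fin 2) ℂ))‖ with hnY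
  set η2 : ℝ := ((eta F n K)⁻¹) ^ 2 with hη2
  clear_value HU H1 DU D1 PU P1 RU R1 KU K1 nX nY η2
  -- real bookkeeping
  have hnYX : nY = nX := hnXσ'
  have hθ1 : 0 ≤ 1 + θ⁻¹ := by positivity
  -- (a)
  have hH : H1 - (((1 + θ⁻¹) * (16 * η2 * δ ^ 2) + (1 + θ) * (1029 * ε₀))) * nX ^ 2 ≤ (1 + θ) * HU := by
    have h2 := (abs_sub_le_iff.1 ha_row).2
    linarith [h2]
  -- (b)
  have hD : D1 ^ 2 - ((1 + θ⁻¹) * (12 * η2 * δ ^ 2)) * nX ^ 2 ≤ (1 + θ) * DU ^ 2 := by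
    have h2 := (abs_sub_le_iff.1 hb_row).2
    linarith [h2]
  -- (p)
  have hP : PU ^ 2 ≤ P1 ^ 2 + (δP + θ) * DU ^ 2 + ((1 + θ⁻¹) * (12 * η2 * δ ^ 2)) * nX ^ 2 := by
    have h1 := (abs_sub_le_iff.1 hp_row).1
    linarith [h1]
  -- (k)
  have hK : a * K1 ^ 2 - (a * cK) * nX ^ 2 ≤ (1 + θ) * (a * KU ^ 2) := by
    have h3 := mul_le_mul_of_nonneg_left hKrow ha
    have e3 : a * ((1 + θ) * KU ^ 2 + cK * nX ^ 2) = (1 + θ) * (a * KU ^ 2) + (a * cK) * nX ^ 2 := by ring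
    linarith [h3, e3]
  -- flat absorption and Org-I line 1
  have hP1n : P1 ^ 2 ≤ c₆ * nX ^ 2 := by rw [← hnYX]; linarith [hP1abs, hR1']
  have hP1D1 : P1 ^ 2 ≤ D1 ^ 2 := pow_le_pow_left₀ hP10 hP1D1' 2
  -- the arithmetic
  have key := localComparison_of_four_rows (HU := HU) (H1 := H1) (DU := DU ^ 2) (D1 := D1 ^ 2) (PU := PU ^ 2) (P1 := P1 ^ 2)
    (KU := a * KU ^ 2) (K1 := a * K1 ^ 2) (t₁ := θ) (t₂ := θ) (t₃ := δP + θ) (t₄ := θ) (θ' := 3 * θ + δP)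
    (c₁ := ((1 + θ⁻¹) * (16 * η2 * δ ^ 2) + (1 + θ) * (1029 * ε₀))) (c₂ := (1 + θ⁻¹) * (12 * η2 * δ ^ 2))
    (c₃ := (1 + θ⁻¹) * (12 * η2 * δ ^ 2)) (c₄ := a * cK) (c₆ := c₆) (n := nX ^ 2)
    hθ.le hθ.le (by positivity) hθ.le (by linarith) (by linarith) (by linarith) hsmall
    (by positivity) (by positivity) (by positivity) (by positivity) hH1nn (by positivity) hP1D1 (by positivity) hH hD hP hK hP1n
  have e : (θ + (δP + θ)) * c₆ = (2 * θ + δP) * c₆ := by ring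
  rw [e] at key
  -- `‖R f‖² = D − P` on both sides
  have hRUe : RU ^ 2 = DU ^ 2 - PU ^ 2 := by linarith [hRU']
  have hR1e : R1 ^ 2 = D1 ^ 2 - P1 ^ 2 := by linarith [hR1']
  rw [hRUe, hR1e]
  linarith [key]

end Summit.QuantumFields.YangMills.Theorems.Prop7LocalComparisonKnit

end
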